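/-
Copyright: the b2b-balaban T⁴-continuum CRUX team, row NE7b, leaf lineage `t4-ne7b-formalise-leaf-02` (gen 131). Project licence.
-/
import Mathlib.Data.ZMod.Basic
import Mathlib.Data.Fin.VecNotation

/-!
# PLAQUETTES PER BOND ON THE PERIODIC LATTICE: on `(ℤ∕L)^d` every bond lies in at most `2(d−1)` plaquettes (`= 6` at `d = 4`), and the four
# bonds of a plaquette are distinct once `L > 1` — the lattice-geometric overlap number `ν` that `…PlaquetteCubicLattice` ∕
# `…ConvexWindowSuppliersCells` DISPLAY, as a kernel count (row NE7b, node U5c; letter (ℓ1): the second factor of the desk's «block row constant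
# 6 per plaquette × 6 plaquettes per bond = 36», ρ-ne7bref-g75-1, AS A THEOREM)

Cell `pub-balaban`, sub-cell `t4`, spine estimate NE7b (`T4WeightBudget.RelWeightBound`; the cell's OWN estimate — NOT PRINTED in
[Bałaban 1983–89], NOT PROVED).  Crux-route work under `Spine/NE7b/` by the row's E-side ∕ key-readings ∕ lattice-geometry leaf lineage; NOTHING
of Bałaban's is named or asserted; no `T4Continuum/Support` leaf typed; no `def`, no notation; zero `sorry`.  Imports: Mathlib ONLY (independent of
the hub's olean frontier).

WHY.  The windowed road's block-Schur END for a sum of cell-local terms (`…ConvexWindowSuppliersCells`, and its plaquette-cubic instance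
`…PlaquetteCubicLattice`) displays ONE lattice-geometric number: `ν`, a bound on the number of cells (plaquettes) through a block (bond), in the
consumer form `∀ b, #{p | b ∈ image (ι p)} ≤ ν` where `ι p : Fin 4 → B` lists the bonds of plaquette `p`.  On the periodic lattice `(ℤ∕L)^d` with
sites `x : Fin d → ZMod L`, bonds `(x, μ)` (the edge from `x` to `x + e_μ`) and plaquettes `(x, μ < ν)` with edges
`(x, μ), (x + e_μ, ν), (x + e_ν, μ), (x, ν)`, the bond `(x, μ)` lies exactly in the plaquettes based at `x` or at `x − e_ν` in a plane `{μ, ν}`,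
`ν ≠ μ`: at most `2(d−1)` of them — `6` at `d = 4`, the desk's second factor.  THIS FILE is that count, and the distinctness of the four edges
(the `hι : Injective (ι p)` of `…PlaquetteCubicLattice`) for `L > 1`.

WHAT IS PROVED ([folklore] lattice geometry; the plaquette-to-bonds map `ι` is carried by its characterising hypothesis
`hι : ι (x, ⟨(μ, ν), _⟩) = ![(x, μ), (x + e_μ, ν), (x + e_ν, μ), (x, ν)]`, `e_μ = Pi.single μ 1`, inhabited by `exists_plaquetteBonds`):
* `exists_plaquetteBonds` (the map exists); `ne_add_single` (`x ≠ x + e_μ` on `(ℤ∕L)^d`, `1 < L`).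
* **`plaquetteBonds_injective`**: for `1 < L` the four bonds of every plaquette are pairwise distinct.
* the cover of the plaquettes through `(x, μ)` by `{ν // ν ≠ μ} × Bool` (plane partner; «based at `x`» ∕ «based at `x − e_ν`»):
  `filter_subset_image_cover`, `image_cover_subset_filter` (any `L`), `cover_injective` (`1 < L`).
* **`card_plaquettes_through_bond_le`**: `#{p | b ∈ image (ι p)} ≤ 2·(d − 1)` for every bond `b` and EVERY `L` — the consumer form `hν`;
  **`card_plaquettes_through_bond_eq`**: `= 2·(d − 1)` for `1 < L`; at `d = 4`: `card_plaquettes_through_bond_le_six` ∕ `…_eq_six` (`6`).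

NOT HERE (honest): the junction with `…PlaquetteCubicLattice`'s END
(modulus `2σ − 12(d−1)γa`, `= 2σ − 36γa` at `d = 4`) — one `have` away once both oleans exist, left to the consumer so that this count stays
Mathlib-only; which lattice, scale and block chart are Bałaban's at step `k` ((A3) ∕ (A1c)); anything of Bałaban's.  BY-NAME EFFECT ON THE WALL:
NONE.  NE7b NOT PRINTED ∕ NOT PROVED; spine PROVED 0∕9; rung (B)+1 on a FINITE torus — NOT infinite volume, NOT the mass gap, NOT Clay.
HONEST DEPENDENCY: continuum YM on T⁴ ⇐ BetaPertH ∧ nine spine estimates (0/9 proved); BetaPertH ⇐ (D1) ∧ (D4) ∧ CAP+tail.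
-/

set_option autoImplicit false

namespace Summit.QuantumFields.BalabanUV.T4Continuum.NE7b.TorusPlaquetteIncidence

open Finset

variable {d L : ℕ}

/-- **THE PLAQUETTE-TO-BONDS MAP EXISTS**: plaquette `(x, μ < ν)` ↦ its four edges `(x, μ), (x + e_μ, ν), (x + e_ν, μ), (x, ν)`. [folklore] -/
theorem exists_plaquetteBonds :
    ∃ ι : (Fin d → ZMod L) × {a : Fin d × Fin d // a.1 < a.2} → Fin 4 → (Fin d → ZMod L) × Fin d,
      ∀ x a, ι (x, a) = ![(x, a.1.1), (x + Pi.single a.1.1 1, a.1.2), (x + Pi.single a.1.2 1, a.1.1), (x, a.1.2)] :=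
  ⟨fun q => ![(q.1, q.2.1.1), (q.1 + Pi.single q.2.1.1 1, q.2.1.2), (q.1 + Pi.single q.2.1.2 1, q.2.1.1), (q.1, q.2.1.2)],
    fun _ _ => rfl⟩

/-- On `(ℤ∕L)^d` with `1 < L` a site differs from its neighbour: `x ≠ x + e_μ`. [folklore] -/
theorem ne_add_single [Fact (1 < L)] (x : Fin d → ZMod L) (μ : Fin d) : x ≠ x + Pi.single μ 1 := by
  intro h
  have h1 := congrFun h μ
  simp only [Pi.add_apply, Pi.single_eq_same, left_eq_add] at h1
  exact one_ne_zero h1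

/-- **THE FOUR BONDS OF A PLAQUETTE ARE DISTINCT** (`1 < L`): `ι p` is injective for every plaquette `p` — the hypothesis `hι` of
`…PlaquetteCubicLattice` for the periodic lattice. [folklore] -/
theorem plaquetteBonds_injective [Fact (1 < L)]
    (ι : (Fin d → ZMod L) × {a : Fin d × Fin d // a.1 < a.2} → Fin 4 → (Fin d → ZMod L) × Fin d)
    (hι : ∀ x a, ι (x, a) = ![(x, a.1.1), (x + Pi.single a.1.1 1, a.1.2), (x + Pi.single a.1.2 1, a.1.1), (x, a.1.2)])
    (p : (Fin d → ZMod L) × {a : Fin d × Fin d // a.1 < a.2}) : Function.Injective (ι p) := by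
  obtain ⟨x, ⟨⟨μ, ν⟩, hμν⟩⟩ := p
  have hne : μ ≠ ν := ne_of_lt hμν
  have h1 := ne_add_single x μ
  have h2 := ne_add_single x ν
  intro i j hij
  rw [hι] at hij
  fin_cases i <;> fin_cases j <;>
    simp only [Fin.zero_eta, Fin.mk_one, Fin.reduceFinMk, Matrix.cons_val_zero, Matrix.cons_val_one, Matrix.cons_val,
      Prod.mk.injEq] at hij ⊢ <;>
    first
    | rfl
    | exact absurd hij.2 hne
    | exact absurd hij.2 hne.symm
    | exact absurd hij.1 h1
    | exact absurd hij.1 h1.symm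
    | exact absurd hij.1 h2
    | exact absurd hij.1 h2.symm

/-- **THE COVER**: the plaquettes through the bond `(x, μ)` lie in the image of `{ν // ν ≠ μ} × Bool` under
`(ν, side) ↦ (base, plane {μ, ν})`, `base = x` (`side = true`: edges `(x, μ)` ∕ `(x, ν)` of a plaquette based at `x`) or `x − e_ν`
(`side = false`: the edges `(x − e_ν + e_ν, ·)`).  Any `L`. [folklore] -/
theorem filter_subset_image_cover [NeZero L]
    (ι : (Fin d → ZMod L) × {a : Fin d × Fin d // a.1 < a.2} → Fin 4 → (Fin d → ZMod L) × Fin d)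
    (hι : ∀ x a, ι (x, a) = ![(x, a.1.1), (x + Pi.single a.1.1 1, a.1.2), (x + Pi.single a.1.2 1, a.1.1), (x, a.1.2)])
    (x : Fin d → ZMod L) (μ : Fin d) :
    (univ.filter fun p : (Fin d → ZMod L) × {a : Fin d × Fin d // a.1 < a.2} => (x, μ) ∈ univ.image (ι p))
      ⊆ univ.image (fun q : {ν : Fin d // ν ≠ μ} × Bool =>
        ((if q.2 then x else x - Pi.single q.1.1 1, ⟨(min μ q.1.1, max μ q.1.1), min_lt_max.2 q.1.2.symm⟩) :
          (Fin d → ZMod L) × {a : Fin d × Fin d // a.1 < a.2})) := by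
  classical
  intro p hp
  simp only [Finset.mem_filter, Finset.mem_univ, true_and, Finset.mem_image] at hp ⊢
  obtain ⟨j, hj⟩ := hp
  obtain ⟨y, ⟨⟨α, β⟩, hαβ⟩⟩ := p
  rw [hι] at hj
  fin_cases j <;>
    simp only [Fin.zero_eta, Fin.mk_one, Fin.reduceFinMk, Matrix.cons_val_zero, Matrix.cons_val_one, Matrix.cons_val,
      Prod.mk.injEq] at hj
  · -- edge `(y, α) = (x, μ)`: based at `x`, partner `β`
    obtain ⟨rfl, rfl⟩ := hj
    refine ⟨(⟨β, ne_of_gt hαβ⟩, true), ?_⟩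
    simp [min_eq_left hαβ.le, max_eq_right hαβ.le]
  · -- edge `(y + e_α, β) = (x, μ)`: based at `x − e_α`, partner `α`
    obtain ⟨rfl, rfl⟩ := hj
    refine ⟨(⟨α, ne_of_lt hαβ⟩, false), ?_⟩
    simp [min_eq_right hαβ.le, max_eq_left hαβ.le]
  · -- edge `(y + e_β, α) = (x, μ)`: based at `x − e_β`, partner `β`
    obtain ⟨rfl, rfl⟩ := hj
    refine ⟨(⟨β, ne_of_gt hαβ⟩, false), ?_⟩
    simp [min_eq_left hαβ.le, max_eq_right hαβ.le]
  · -- edge `(y, β) = (x, μ)`: based at `x`, partner `α`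
    obtain ⟨rfl, rfl⟩ := hj
    refine ⟨(⟨α, ne_of_lt hαβ⟩, true), ?_⟩
    simp [min_eq_right hαβ.le, max_eq_left hαβ.le]

/-- **CONVERSELY** every plaquette of the cover passes through `(x, μ)`. [folklore] -/
theorem image_cover_subset_filter [NeZero L]
    (ι : (Fin d → ZMod L) × {a : Fin d × Fin d // a.1 < a.2} → Fin 4 → (Fin d → ZMod L) × Fin d)
    (hι : ∀ x a, ι (x, a) = ![(x, a.1.1), (x + Pi.single a.1.1 1, a.1.2), (x + Pi.single a.1.2 1, a.1.1), (x, a.1.2)])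
    (x : Fin d → ZMod L) (μ : Fin d) :
    univ.image (fun q : {ν : Fin d // ν ≠ μ} × Bool =>
        ((if q.2 then x else x - Pi.single q.1.1 1, ⟨(min μ q.1.1, max μ q.1.1), min_lt_max.2 q.1.2.symm⟩) :
          (Fin d → ZMod L) × {a : Fin d × Fin d // a.1 < a.2}))
      ⊆ univ.filter fun p : (Fin d → ZMod L) × {a : Fin d × Fin d // a.1 < a.2} => (x, μ) ∈ univ.image (ι p) := by
  classical
  intro p hp
  simp only [Finset.mem_filter, Finset.mem_univ, true_and, Finset.mem_image] at hp ⊢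
  obtain ⟨⟨⟨ν, hν⟩, side⟩, rfl⟩ := hp
  rw [hι]
  rcases lt_or_gt_of_ne hν with h | h
  · -- `ν < μ`: plane `(ν, μ)`; edge 3 (based at `x`) or edge 1 (based at `x − e_ν`)
    cases side
    · exact ⟨1, by simp [min_eq_right h.le, max_eq_left h.le]⟩
    · exact ⟨3, by simp [min_eq_right h.le, max_eq_left h.le]⟩
  · -- `μ < ν`: plane `(μ, ν)`; edge 0 (based at `x`) or edge 2 (based at `x − e_ν`)
    cases side
    · exact ⟨2, by simp [min_eq_left h.le, max_eq_right h.le]⟩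
    · exact ⟨0, by simp [min_eq_left h.le, max_eq_right h.le]⟩

/-- The cover is INJECTIVE once `1 < L` (distinct partners give distinct planes; the two base points `x`, `x − e_ν` differ). [folklore] -/
theorem cover_injective [Fact (1 < L)] (x : Fin d → ZMod L) (μ : Fin d) :
    Function.Injective (fun q : {ν : Fin d // ν ≠ μ} × Bool =>
        ((if q.2 then x else x - Pi.single q.1.1 1, ⟨(min μ q.1.1, max μ q.1.1), min_lt_max.2 q.1.2.symm⟩) :
          (Fin d → ZMod L) × {a : Fin d × Fin d // a.1 < a.2})) := by
  rintro ⟨⟨ν, hν⟩, s⟩ ⟨⟨ν', hν'⟩, s'⟩ h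
  simp only [Prod.mk.injEq, Subtype.mk.injEq] at h
  obtain ⟨hbase, hmin, hmax⟩ := h
  -- the partner: `{min μ ν, max μ ν} = {μ, ν}` determines `ν`
  have hνν' : ν = ν' := by
    rcases lt_or_gt_of_ne hν with h1 | h1 <;> rcases lt_or_gt_of_ne hν' with h2 | h2 <;>
      simp only [min_eq_right h1.le, max_eq_left h1.le, min_eq_left h1.le, max_eq_right h1.le, min_eq_right h2.le,
        max_eq_left h2.le, min_eq_left h2.le, max_eq_right h2.le] at hmin hmax
    · exact hmin
    · exact absurd hmax.symm hν'
    · exact absurd hmax hν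
    · exact hmax
  subst hνν'
  -- the base point: `x ≠ x − e_ν`
  have hx : x ≠ x - Pi.single ν 1 := fun h => ne_add_single (x - Pi.single ν 1) ν (by rw [sub_add_cancel]; exact h.symm)
  cases s <;> cases s' <;> simp_all

/-- **PLAQUETTES PER BOND: AT MOST `2(d−1)`** on `(ℤ∕L)^d` (any `L`) — the consumer form `hν` of `…ConvexWindowSuppliersCells` ∕
`…PlaquetteCubicLattice` (`Finset.card_le_card` on the cover, `card_image_le`, `#({ν // ν ≠ μ} × Bool) = 2(d−1)`). [folklore] -/
theorem card_plaquettes_through_bond_le [NeZero L]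
    (ι : (Fin d → ZMod L) × {a : Fin d × Fin d // a.1 < a.2} → Fin 4 → (Fin d → ZMod L) × Fin d)
    (hι : ∀ x a, ι (x, a) = ![(x, a.1.1), (x + Pi.single a.1.1 1, a.1.2), (x + Pi.single a.1.2 1, a.1.1), (x, a.1.2)])
    (b : (Fin d → ZMod L) × Fin d) :
    (univ.filter fun p : (Fin d → ZMod L) × {a : Fin d × Fin d // a.1 < a.2} => b ∈ univ.image (ι p)).card ≤ 2 * (d - 1) := by
  classical
  obtain ⟨x, μ⟩ := b
  have hdom : Fintype.card ({ν : Fin d // ν ≠ μ} × Bool) = 2 * (d - 1) := by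
    rw [Fintype.card_prod, Fintype.card_bool, Fintype.card_subtype, Finset.filter_ne', Finset.card_erase_of_mem (Finset.mem_univ μ),
      Finset.card_univ, Fintype.card_fin, mul_comm]
  calc _ ≤ _ := Finset.card_le_card (filter_subset_image_cover ι hι x μ)
    _ ≤ Fintype.card ({ν : Fin d // ν ≠ μ} × Bool) := Finset.card_image_le.trans (by rw [Finset.card_univ])
    _ = 2 * (d - 1) := hdom

/-- **PLAQUETTES PER BOND: EXACTLY `2(d−1)`** on `(ℤ∕L)^d` for `1 < L` (the cover is a bijection onto the plaquettes through the bond). [folklore] -/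
theorem card_plaquettes_through_bond_eq [NeZero L] [Fact (1 < L)]
    (ι : (Fin d → ZMod L) × {a : Fin d × Fin d // a.1 < a.2} → Fin 4 → (Fin d → ZMod L) × Fin d)
    (hι : ∀ x a, ι (x, a) = ![(x, a.1.1), (x + Pi.single a.1.1 1, a.1.2), (x + Pi.single a.1.2 1, a.1.1), (x, a.1.2)])
    (b : (Fin d → ZMod L) × Fin d) :
    (univ.filter fun p : (Fin d → ZMod L) × {a : Fin d × Fin d // a.1 < a.2} => b ∈ univ.image (ι p)).card = 2 * (d - 1) := by
  classical
  obtain ⟨x, μ⟩ := b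
  rw [Finset.Subset.antisymm (filter_subset_image_cover ι hι x μ) (image_cover_subset_filter ι hι x μ),
    Finset.card_image_of_injective _ (cover_injective x μ), Finset.card_univ, Fintype.card_prod, Fintype.card_bool,
    Fintype.card_subtype, Finset.filter_ne', Finset.card_erase_of_mem (Finset.mem_univ μ), Finset.card_univ, Fintype.card_fin, mul_comm]

/-- **AT `d = 4`: AT MOST SIX PLAQUETTES PER BOND** (any `L`) — the desk's second factor in `36 = 6 × 6` (ρ-ne7bref-g75-1). [folklore] -/
theorem card_plaquettes_through_bond_le_six [NeZero L]
    (ι : (Fin 4 → ZMod L) × {a : Fin 4 × Fin 4 // a.1 < a.2} → Fin 4 → (Fin 4 → ZMod L) × Fin 4)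
    (hι : ∀ x a, ι (x, a) = ![(x, a.1.1), (x + Pi.single a.1.1 1, a.1.2), (x + Pi.single a.1.2 1, a.1.1), (x, a.1.2)])
    (b : (Fin 4 → ZMod L) × Fin 4) :
    (univ.filter fun p : (Fin 4 → ZMod L) × {a : Fin 4 × Fin 4 // a.1 < a.2} => b ∈ univ.image (ι p)).card ≤ 6 :=
  card_plaquettes_through_bond_le ι hι b

/-- **AT `d = 4`, `1 < L`: EXACTLY SIX PLAQUETTES PER BOND.** [folklore] -/
theorem card_plaquettes_through_bond_eq_six [NeZero L] [Fact (1 < L)]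
    (ι : (Fin 4 → ZMod L) × {a : Fin 4 × Fin 4 // a.1 < a.2} → Fin 4 → (Fin 4 → ZMod L) × Fin 4)
    (hι : ∀ x a, ι (x, a) = ![(x, a.1.1), (x + Pi.single a.1.1 1, a.1.2), (x + Pi.single a.1.2 1, a.1.1), (x, a.1.2)])
    (b : (Fin 4 → ZMod L) × Fin 4) :
    (univ.filter fun p : (Fin 4 → ZMod L) × {a : Fin 4 × Fin 4 // a.1 < a.2} => b ∈ univ.image (ι p)).card = 6 :=
  card_plaquettes_through_bond_eq ι hι b

end Summit.QuantumFields.BalabanUV.T4Continuum.NE7b.TorusPlaquetteIncidence
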